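import Summits.ValiantsHypothesis.ValiantsHypothesis.Theorems.BIPWhatWouldSuffice
import Literature.Computability.AlgebraicComplexity.MultiplicityObstructionWeights
import Literature.Computability.AlgebraicComplexity.PerDetObstructionKindsNoOccurrence
import HarnessLib

/-!
# BIP corpus — «what would suffice» chain for rung V3, part 3: GCT II multiplicity obstructions
# in MODULE FORM ⇔ the rung `MultObstructionPer3Det4` ⇔-family the summit hypothesis

Continuation of `Theorems/BIPWhatWouldSuffice.lean` (part 1, links (a)–(f)) and
`Theorems/BIPWhatWouldSufficeTyped.lean` (part 2, links (g)–(q′)) of the val-lit cell (D-0074 GROUP L).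
Part 2's links (m″)–(m⁗) turned a module-form OCCURRENCE obstruction (Mulmuley–Sohoni GCT II, Def. 1.2,
occurrence reading; `HasOccurrenceObstruction`) or a STRONG obstruction (Def. 1.3,
`HasStrongObstruction`) for `(X₀₀ per₃, det₄)` into the rung. This part does the same for the
MULTIPLICITY reading of GCT II Def. 1.2 — `HasMultiplicityObstruction f g m d`: "there is no surjective
`GL`-equivariant map `ℂ[Δ_m[f]]_d ↠ ℂ[Δ_m[g]]_d`" (`GCTObstructions.lean`) — using the isotypic-counting
bridge landed in this wave by val-lit-t01 (`MultiplicityObstructionWeights.lean`,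
`exists_isMultiplicityObstructionAt_of_hasMultiplicityObstruction`: module form ⇒ some highest weight
`χ` with `mult_χ ℂ[Δ_m[f]] < mult_χ ℂ[Δ_m[g]]`, characteristic `0`, `m ≠ 0`; converse
`exists_hasMultiplicityObstruction_of_isMultiplicityObstructionAt`, `OccurrenceObstructionWeights.lean`).

Consequently the rung is LITERALLY EQUIVALENT to «a GCT II multiplicity obstruction (module form)
exists for `(X₀₀ per₃, det₄)` in some degree» (link (r), `multObstructionPer3Det4_iff_exists_hasMultiplicityObstruction`),
and the summit hypothesis `Summit.PneNP.GCT.MultObstructionsBeyondQuasiPoly` of `SufficesForValiant.lean`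
is literally equivalent to its module-form family version (link (s)); hence (t): a family of module-form
GCT II multiplicity obstructions at `(X₀₀^{n-m} per_m, det_n)`, one for every quasi-polynomial template,
implies `ValiantsHypothesis` — the Mulmuley–Sohoni programme statement (GCT II §3, "obstructions
should exist"), typed over the tree's objects with every arrow a theorem.

Honest framing (as in parts 1–2). `VP ≠ VNP` is NOT proved here or anywhere in the tree. Every theorem
below is a sorry-free composition of tree theorems; the OPEN content is the hypothesis binder (no
multiplicity obstruction is known at `(3, 4)` or at any open pair; BIP 2019 Thm. 1.4 excludes only
OCCURRENCE obstructions and only for `n ≥ m²⁵`, so multiplicity obstructions in the quasi-polynomial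
window are neither known nor excluded). `(3, 4)` is a KNOWN separation (`dc̄(per₃) ≥ 5`, LMR 2013): a
proof of the rung would validate the multiplicity-obstruction METHOD there, not give a new lower bound.
Nothing in this file is a new named fact; no conjecture is asserted.

Links in this file:
* (r) `multObstructionPer3Det4_of_hasMultiplicityObstruction` (+ `_matrix` twin over `Fin 4 × Fin 4`,
  + the two `iff`s): module-form multiplicity obstruction at `(3,4)` in degree `d` ⇒ / ⇔∃d the rung.
* (s) `multObstructionsBeyondQuasiPoly_iff_moduleFormFamily`: the summit hypothesis ⇔ its module-form
  family version (+ `_matrix`).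
* (t) `valiantsHypothesis_of_moduleFormFamily` (+ `_matrix`): the module-form family ⇒ `ValiantsHypothesis`,
  through `Summit.PneNP.GCT.sufficesForVPneVNP_holds`.
-/

namespace Summit.ValiantsHypothesis.BIPWhatWouldSufficeMult

open Literature.Computability.AlgebraicComplexity Literature.NumberTheory.DiophantineGeometry
open Summit.PneNP.GCT

/-! ### Transport between the lexicographic copy `MatIdx n` and `Fin n × Fin n` -/

/-- Renaming along `toLex` does not change the module-form multiplicity-obstruction predicate
(`MatIdx n` is a type synonym of `Fin n × Fin n` and `toLex` the identity: same `GL`, same coordinate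
rings, same gradings); public twin of the private transport used for
`PerDetMultiplicityObstruction.exists_hasMultiplicityObstruction` (`PerDetObstructionKindsNoOccurrence.lean`).
[folklore] -/
theorem hasMultiplicityObstruction_rename_toLex_iff {k : Type} [Field k] {n : ℕ}
    (f g : MvPolynomial (Fin n × Fin n) k) (M d : ℕ) :
    HasMultiplicityObstruction (σ := MatIdx n) (MvPolynomial.rename toLex f)
      (MvPolynomial.rename toLex g) M d ↔
      HasMultiplicityObstruction f g M d := by
  have hf : (MvPolynomial.rename toLex f : MvPolynomial (MatIdx n) k) = f :=
    MvPolynomial.rename_id_apply f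
  have hg : (MvPolynomial.rename toLex g : MvPolynomial (MatIdx n) k) = g :=
    MvPolynomial.rename_id_apply g
  rw [hf, hg]
  exact Iff.rfl

/-- The transport at `(det_n, X₀₀^{n-m} per_m)`: `detFormLex` / `paddedPerFormLex` are the `toLex`-renamed
`detPoly (Fin n)` / `paddedPerPoly`. [folklore] -/
theorem hasMultiplicityObstruction_detFormLex_iff (m n d : ℕ) [NeZero n] :
    HasMultiplicityObstruction (detFormLex ℂ n) (paddedPerFormLex ℂ m n) n d ↔
      HasMultiplicityObstruction (detPoly (Fin n) ℂ) (paddedPerPoly ℂ m n) n d :=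
  hasMultiplicityObstruction_rename_toLex_iff (detPoly (Fin n) ℂ) (paddedPerPoly ℂ m n) n d

/-! ### (r) A module-form multiplicity obstruction at `(3, 4)` ⇔ the rung -/

/-- **(r) A module-form MULTIPLICITY obstruction for `(X₀₀ per₃, det₄)` in any degree `d` gives the rung.**
`HasMultiplicityObstruction (det₄) (X₀₀ per₃) 4 d` — no surjective `GL₁₆`-intertwiner
`ℂ[Δ_4[det₄]]_d ↠ ℂ[Δ_4[X₀₀ per₃]]_d` (GCT II Def. 1.2 in the multiplicity reading "`V_λ` occurs in
`ℂ[Z]_d` with larger multiplicity than in `ℂ[Ω]_d`"; BIP 2019 §1(a)) ⟹ some highest weight `χ` with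
`mult_χ(det₄) < mult_χ(X₀₀ per₃)` (isotypic counting,
`exists_isMultiplicityObstructionAt_of_hasMultiplicityObstruction`) = the rung (`MultObstructionPer3Det4`).
OPEN hypothesis at `(3, 4)`; nothing here is evidence that it holds.
[cite: MulmuleySohoniGCT2SIAM2008, Def. 1.2 (obstruction; multiplicity reading)]
[cite: BurgisserIkenmeyerPanovaJAMS2019, §1(a) (multiplicity obstructions)] -/
theorem multObstructionPer3Det4_of_hasMultiplicityObstruction {d : ℕ}
    (h : HasMultiplicityObstruction (detFormLex ℂ 4) (paddedPerFormLex ℂ 3 4) 4 d) :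
    MultObstructionPer3Det4 := by
  obtain ⟨χ, hχ⟩ := exists_isMultiplicityObstructionAt_of_hasMultiplicityObstruction
    (f := detFormLex ℂ 4) (g := paddedPerFormLex ℂ 3 4) (by norm_num) h
  exact ⟨χ, perDetMultiplicityObstruction_iff.mpr ⟨by norm_num, hχ⟩⟩

/-- **(r, matrix indices)** the same with the hypothesis over `Fin 4 × Fin 4`
(`detPoly (Fin 4) ℂ`, `paddedPerPoly ℂ 3 4`) — the variables of route GCTMult's crux `GctMultObstructions`.
[cite: MulmuleySohoniGCT2SIAM2008, Def. 1.2 (obstruction; multiplicity reading)] -/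
theorem multObstructionPer3Det4_of_hasMultiplicityObstruction_matrix {d : ℕ}
    (h : HasMultiplicityObstruction (detPoly (Fin 4) ℂ) (paddedPerPoly ℂ 3 4) 4 d) :
    MultObstructionPer3Det4 :=
  multObstructionPer3Det4_of_hasMultiplicityObstruction ((hasMultiplicityObstruction_detFormLex_iff 3 4 d).mpr h)

/-- **The rung ⇔ a module-form multiplicity obstruction for `(X₀₀ per₃, det₄)` in some degree**
(lexicographic copy). `⇒`: the weight of a numeric obstruction pins a degree `d` with `|χ| = -4d` in which
no surjective intertwiner exists (`exists_hasMultiplicityObstruction_of_isMultiplicityObstructionAt`,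
Bläser–Ikenmeyer Cor. 12.6); `⇐`: link (r). So rung V3 is, verbatim, «a GCT II multiplicity obstruction
exists at `(3, 4)`». OPEN on both sides; an equivalence of open statements, not evidence for either.
[cite: BurgisserIkenmeyerPanovaJAMS2019, §1(a) (multiplicity obstructions)] -/
theorem multObstructionPer3Det4_iff_exists_hasMultiplicityObstruction :
    MultObstructionPer3Det4 ↔
      ∃ d : ℕ, HasMultiplicityObstruction (detFormLex ℂ 4) (paddedPerFormLex ℂ 3 4) 4 d := by
  constructor
  · rintro ⟨χ, hχ⟩
    obtain ⟨d, -, hd⟩ := exists_hasMultiplicityObstruction_of_isMultiplicityObstructionAt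
      (f := detFormLex ℂ 4) (g := paddedPerFormLex ℂ 3 4) (by norm_num)
      (perDetMultiplicityObstruction_iff.mp hχ).2
    exact ⟨d, hd⟩
  · rintro ⟨d, hd⟩
    exact multObstructionPer3Det4_of_hasMultiplicityObstruction hd

/-- **The rung ⇔ a module-form multiplicity obstruction in some degree**, matrix indices `Fin 4 × Fin 4`
(`⇒` is `PerDetMultiplicityObstruction.exists_hasMultiplicityObstruction` of
`PerDetObstructionKindsNoOccurrence.lean` with the degree bookkeeping dropped).
[cite: BurgisserIkenmeyerPanovaJAMS2019, §1(a) (multiplicity obstructions)] -/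
theorem multObstructionPer3Det4_iff_exists_hasMultiplicityObstruction_matrix :
    MultObstructionPer3Det4 ↔
      ∃ d : ℕ, HasMultiplicityObstruction (detPoly (Fin 4) ℂ) (paddedPerPoly ℂ 3 4) 4 d := by
  rw [multObstructionPer3Det4_iff_exists_hasMultiplicityObstruction]
  exact exists_congr fun d => hasMultiplicityObstruction_detFormLex_iff 3 4 d

/-! ### (s) The summit hypothesis ⇔ its module-form family version; (t) ⇒ `ValiantsHypothesis` -/

/-- **(s) `MultObstructionsBeyondQuasiPoly` ⇔ the MODULE-FORM family**: «for every `c` some pair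
`(per_m, det_n)` with `m ≤ n` and `2^((log₂ m + c)^c) ≤ n` carries, in some degree `d`, a GCT II
multiplicity obstruction — no surjective `GL_{n²}`-intertwiner `ℂ[Δ_n[det_n]]_d ↠ ℂ[Δ_n[X₀₀^{n-m} per_m]]_d`»
is equivalent to the numeric family hypothesis of `SufficesForValiant.lean` (degree-wise:
`hasMultiplicityObstruction_iff_exists_isMultiplicityObstructionAt`). Both sides are OPEN hypotheses
(Mulmuley–Sohoni GCT II §3 expects such obstructions to exist; none is known at any open pair); this is
an equivalence of hypothesis SHAPES, not evidence. [cite: MulmuleySohoniGCT2SIAM2008, Def. 1.2 and §3 (obstructions should exist)]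
[cite: BurgisserIkenmeyerPanovaJAMS2019, §1(a) (multiplicity obstructions)] -/
theorem multObstructionsBeyondQuasiPoly_iff_moduleFormFamily :
    MultObstructionsBeyondQuasiPoly ↔
      ∀ c : ℕ, ∃ (m n : ℕ) (_ : NeZero n) (d : ℕ), m ≤ n ∧ 2 ^ ((Nat.log 2 m + c) ^ c) ≤ n ∧
        HasMultiplicityObstruction (detFormLex ℂ n) (paddedPerFormLex ℂ m n) n d := by
  constructor
  · intro h c
    obtain ⟨m, n, hn, χ, hw, hobs⟩ := h c
    obtain ⟨hmn, hlt⟩ := perDetMultiplicityObstruction_iff.mp hobs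
    obtain ⟨d, -, hd⟩ := exists_hasMultiplicityObstruction_of_isMultiplicityObstructionAt
      (f := detFormLex ℂ n) (g := paddedPerFormLex ℂ m n) (NeZero.ne n) hlt
    exact ⟨m, n, hn, d, hmn, hw, hd⟩
  · intro h c
    obtain ⟨m, n, hn, d, hmn, hw, hd⟩ := h c
    obtain ⟨χ, hχ⟩ := exists_isMultiplicityObstructionAt_of_hasMultiplicityObstruction
      (f := detFormLex ℂ n) (g := paddedPerFormLex ℂ m n) (NeZero.ne n) hd
    exact ⟨m, n, hn, χ, hw, perDetMultiplicityObstruction_iff.mpr ⟨hmn, hχ⟩⟩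

/-- **(s, matrix indices)**: the same family over `Fin n × Fin n` (`detPoly (Fin n) ℂ`, `paddedPerPoly ℂ m n`).
[cite: MulmuleySohoniGCT2SIAM2008, Def. 1.2 and §3 (obstructions should exist)] -/
theorem multObstructionsBeyondQuasiPoly_iff_moduleFormFamily_matrix :
    MultObstructionsBeyondQuasiPoly ↔
      ∀ c : ℕ, ∃ (m n : ℕ) (_ : NeZero n) (d : ℕ), m ≤ n ∧ 2 ^ ((Nat.log 2 m + c) ^ c) ≤ n ∧
        HasMultiplicityObstruction (detPoly (Fin n) ℂ) (paddedPerPoly ℂ m n) n d := by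
  rw [multObstructionsBeyondQuasiPoly_iff_moduleFormFamily]
  refine forall_congr' fun c => ?_
  constructor
  · rintro ⟨m, n, hn, d, hmn, hw, hd⟩
    exact ⟨m, n, hn, d, hmn, hw, (hasMultiplicityObstruction_detFormLex_iff m n d).mp hd⟩
  · rintro ⟨m, n, hn, d, hmn, hw, hd⟩
    exact ⟨m, n, hn, d, hmn, hw, (hasMultiplicityObstruction_detFormLex_iff m n d).mpr hd⟩

/-- **(t) A family of module-form GCT II multiplicity obstructions beyond every quasi-polynomial implies
`VP_ℂ ≠ VNP_ℂ`** (`ValiantsHypothesis`): (s) followed by the dc-language chain of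
`SufficesForValiant.lean` (`sufficesForVPneVNP_holds`: obstruction ⇒ `n < dc(per_m)`, Mulmuley–Sohoni 2001
Prop. 4.4 ⇒ `dc(per)` not quasi-polynomially bounded ⇒ `VP ≠ VNP`, VSBR/Valiant/Toda). The hypothesis is
the Mulmuley–Sohoni programme statement (GCT II §3); it is OPEN and nothing here is evidence for it;
`VP ≠ VNP` is not proved. [cite: MulmuleySohoniGCT2SIAM2008, Def. 1.2 and §3 (obstructions should exist)] -/
theorem valiantsHypothesis_of_moduleFormFamily
    (h : ∀ c : ℕ, ∃ (m n : ℕ) (_ : NeZero n) (d : ℕ), m ≤ n ∧ 2 ^ ((Nat.log 2 m + c) ^ c) ≤ n ∧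
      HasMultiplicityObstruction (detFormLex ℂ n) (paddedPerFormLex ℂ m n) n d) :
    ValiantsHypothesis :=
  sufficesForVPneVNP_holds (multObstructionsBeyondQuasiPoly_iff_moduleFormFamily.mpr h)

/-- **(t, matrix indices)**: the module-form family over `Fin n × Fin n` implies `ValiantsHypothesis`.
[cite: MulmuleySohoniGCT2SIAM2008, Def. 1.2 and §3 (obstructions should exist)] -/
theorem valiantsHypothesis_of_moduleFormFamily_matrix
    (h : ∀ c : ℕ, ∃ (m n : ℕ) (_ : NeZero n) (d : ℕ), m ≤ n ∧ 2 ^ ((Nat.log 2 m + c) ^ c) ≤ n ∧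
      HasMultiplicityObstruction (detPoly (Fin n) ℂ) (paddedPerPoly ℂ m n) n d) :
    ValiantsHypothesis :=
  sufficesForVPneVNP_holds (multObstructionsBeyondQuasiPoly_iff_moduleFormFamily_matrix.mpr h)

end Summit.ValiantsHypothesis.BIPWhatWouldSufficeMult
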